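import Literature.MathematicalPhysics.QuantumLattice.SectorisedKernelNorm
import HarnessLib

/-!
# Re-sectorisation with a REFINEMENT COUNT: the anchored sector sums of a leg-wise transformed kernel family cost
# (row sum of the pinned leg) × (per-sector-pair position mass)^m × (number of admissible fine tuples refining a coarse tuple)

Topic `MathematicalPhysics/QuantumLattice`; generic layer (label set `P × S`: positions × discrete sector labels), companion of
`SectorisedKernelNorm` §1 and of `SectorisedKernelNormResectorisation` (the FLAT re-sectorisation across a plateau pair,
`cr · cc^m`, every child of every leg counted).  Benfatto–Giuliani–Mastropietro 2006, (2.83)/(2.89): when the kernels of scale `h_v` are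
rewritten in the sectors of a lower scale `h`, the sector sums are NOT the product of the per-leg child counts but the number of fine
sector tuples COMPATIBLE WITH MOMENTUM CONSERVATION refining the coarse tuple (the relative sector counting lemma, `c^L γ^{(h_v-h)(L-3)/2}`
in `ℝ²`) — times one `L¹` overlap per leg (2.82).  Here, for a fine kernel family obtained from a coarse one by a leg-wise transform
`W″_{σ″}(x″) = Σ_{σ′,x′} ∏_i T((x″_i,σ″_i),(x′_i,σ′_i)) · W_{σ′}(x′)` whose entries vanish unless the fine label is a CHILD of the coarse one:

* **`sectorLegSum_refine_le`** — `legSum_{A″}(W″; p, s″, x) ≤ cr · c₁^m · R · ‖W‖_{univ}`, where `c₁` bounds the position sums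
  `Σ_{x″} ‖T((x″,s″),(x′,s′))‖` per sector pair, `cr` the full row sums `Σ_{X′} ‖T(X″,X′)‖`, and `R` the REFINEMENT COUNT
  `#{σ″ ∈ A″ : σ″_p = s″, σ″_i child of σ′_i ∀ i}` uniformly in the coarse tuple `σ′`;
* **`sectorisedKernelNorm_refine_le`** — the same for the norm: `‖W″‖_{A″} ≤ cr · c₁^m · R · ‖W‖_{univ}`.
* `pinnedSum_refine_le` — the PER-TUPLE companion: for one fine tuple `σ″`, the pinned `L¹` size of `W″_{σ″}` is
  `≤ c₁^m · c₁r · P · B_∞`, with `c₁r` the per-pair ROW position sums, `P` the number of coarse tuples `σ″` refines (its parents) and `B_∞` a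
  bound on the pinned sizes of the single coarse tuples — so a bookkeeping that carries (anchored sum, per-tuple size) pairs can propagate both.

With `R =` (all children)^m this is the flat bound; with `A″ =` a conservation-constrained set and `R` the relative sector count it is
BGM's (2.89) bookkeeping per vertex (cell gate-hubbard-kl, K3 engine child, clause (E1): E1-CORE-TARGET CT-2(ii) / E1-TOWER-AUDIT §3,
the re-sectorisation of an increment born at one scale and measured at a lower one).  Everything is proved; no definition, no named fact.

## Sources

G. Benfatto, A. Giuliani, V. Mastropietro, Ann. Henri Poincaré 7 (2006) 809–898, §2.7 (2.70)–(2.71a), §2.8 (2.82)–(2.83), (2.89)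
[`BenfattoGiulianiMastropietro2006`].
-/

noncomputable section

namespace Literature.MathematicalPhysics.QuantumLattice

open Finset

variable {𝕜 : Type*} [RCLike 𝕜] {S S'' P P'' : Type*} [Fintype S] [DecidableEq S] [DecidableEq S''] [Fintype P] [DecidableEq P]
  [Fintype P''] [DecidableEq P'']

/-- **Anchored sector sums under a child-supported leg-wise transform** (BGM 2006 (2.82)–(2.83), (2.89): one overlap `L¹` norm per
leg and the RELATIVE sector count).  Let `W″_{σ″}(x″) = Σ_{σ′,x′} ∏_i T((x″_i,σ″_i),(x′_i,σ′_i)) W_{σ′}(x′)` with `T((x″,s″),(x′,s′)) = 0`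
unless `child s″ s′`, position sums `Σ_{x″} ‖T((x″,s″),(x′,s′))‖ ≤ c₁`, row sums `Σ_{X′} ‖T(X″,X′)‖ ≤ cr`, and let `R` bound, for every
coarse tuple `σ′`, leg `p` and fine label `s″`, the number of `σ″ ∈ A″` with `σ″_p = s″` and `σ″_i` a child of `σ′_i` for all `i`.  Then
`legSum_{A″}(W″; p, s″, x) ≤ cr · c₁^m · R · ‖W‖_{univ}`. [cite: BenfattoGiulianiMastropietro2006, §2.8 (2.82)-(2.83) and (2.89)] -/
theorem sectorLegSum_refine_le {ε : ℝ} (hε : 0 ≤ ε) {m : ℕ} (T : P'' × S'' → P × S → 𝕜) (child : S'' → S → Prop)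
    [DecidableRel child] (hT0 : ∀ x'' s'' x' s', ¬ child s'' s' → T (x'', s'') (x', s') = 0)
    {c₁ cr R : ℝ} (hc₁ : 0 ≤ c₁) (hR0 : 0 ≤ R)
    (h1 : ∀ (s'' : S'') (x' : P) (s' : S), ∑ x'' : P'', ‖T (x'', s'') (x', s')‖ ≤ c₁)
    (h2 : ∀ X'' : P'' × S'', ∑ X' : P × S, ‖T X'' X'‖ ≤ cr)
    (A'' : Finset (Fin (m + 1) → S''))
    (hR : ∀ (σ' : Fin (m + 1) → S) (p : Fin (m + 1)) (s'' : S''),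
      (((A''.filter fun σ'' => σ'' p = s'' ∧ ∀ i, child (σ'' i) (σ' i)).card : ℝ)) ≤ R)
    (W : (Fin (m + 1) → S) → (Fin (m + 1) → P) → 𝕜) (p : Fin (m + 1)) (s'' : S'') (x : P'') :
    sectorLegSum ε A''
        (fun σ'' x'' => ∑ σ' : Fin (m + 1) → S, ∑ x' : Fin (m + 1) → P, (∏ i, T (x'' i, σ'' i) (x' i, σ' i)) * W σ' x')
        p s'' x ≤
      cr * c₁ ^ m * R * sectorisedKernelNorm ε (m + 1) (univ : Finset (Fin (m + 1) → S)) W := by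
  set nW : ℝ := sectorisedKernelNorm ε (m + 1) (univ : Finset (Fin (m + 1) → S)) W with hnW
  have hnW0 : 0 ≤ nW := sectorisedKernelNorm_nonneg hε _ _ _
  -- abbreviation for the absolute transform entries
  set a : Fin (m + 1) → P'' → S'' → P → S → ℝ := fun _ x'' s'' x' s' => ‖T (x'', s'') (x', s')‖ with ha
  have ha0 : ∀ i x'' s'' x' s', 0 ≤ a i x'' s'' x' s' := fun _ _ _ _ _ => norm_nonneg _
  -- Step 1: triangle inequality and reordering of the sums
  have step1 : sectorLegSum ε A''
        (fun σ'' x'' => ∑ σ' : Fin (m + 1) → S, ∑ x' : Fin (m + 1) → P, (∏ i, T (x'' i, σ'' i) (x' i, σ' i)) * W σ' x') p s'' x ≤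
      ∑ σ' : Fin (m + 1) → S, ∑ x' : Fin (m + 1) → P, ‖W σ' x'‖ *
        (ε ^ m * ∑ σ'' ∈ A''.filter (fun σ'' => σ'' p = s''),
          ∑ x'' ∈ univ.filter (fun x'' : Fin (m + 1) → P'' => x'' p = x), ∏ i, a i (x'' i) (σ'' i) (x' i) (σ' i)) := by
    rw [sectorLegSum]
    calc ∑ σ'' ∈ A''.filter (fun σ'' => σ'' p = s''), ε ^ m *
          ∑ x'' ∈ univ.filter (fun x'' : Fin (m + 1) → P'' => x'' p = x),
            ‖∑ σ' : Fin (m + 1) → S, ∑ x' : Fin (m + 1) → P, (∏ i, T (x'' i, σ'' i) (x' i, σ' i)) * W σ' x'‖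
        ≤ ∑ σ'' ∈ A''.filter (fun σ'' => σ'' p = s''), ε ^ m *
          ∑ x'' ∈ univ.filter (fun x'' : Fin (m + 1) → P'' => x'' p = x),
            ∑ σ' : Fin (m + 1) → S, ∑ x' : Fin (m + 1) → P, (∏ i, a i (x'' i) (σ'' i) (x' i) (σ' i)) * ‖W σ' x'‖ := by
          refine sum_le_sum fun σ'' _ => mul_le_mul_of_nonneg_left (sum_le_sum fun x'' _ => ?_) (pow_nonneg hε _)
          refine (norm_sum_le _ _).trans (sum_le_sum fun σ' _ => (norm_sum_le _ _).trans (sum_le_sum fun x' _ => ?_))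
          rw [norm_mul, norm_prod]
      _ = _ := by
          -- pull `‖W σ' x'‖` to the front: reorder the four sums
          set Ap := A''.filter (fun σ'' => σ'' p = s'') with hAp
          set Xp := univ.filter (fun x'' : Fin (m + 1) → P'' => x'' p = x) with hXp
          calc ∑ σ'' ∈ Ap, ε ^ m * ∑ x'' ∈ Xp, ∑ σ' : Fin (m + 1) → S, ∑ x' : Fin (m + 1) → P,
                (∏ i, a i (x'' i) (σ'' i) (x' i) (σ' i)) * ‖W σ' x'‖
              = ∑ σ'' ∈ Ap, ∑ x'' ∈ Xp, ∑ σ' : Fin (m + 1) → S, ∑ x' : Fin (m + 1) → P,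
                  ε ^ m * ((∏ i, a i (x'' i) (σ'' i) (x' i) (σ' i)) * ‖W σ' x'‖) := by
                simp only [mul_sum]
            _ = ∑ σ'' ∈ Ap, ∑ σ' : Fin (m + 1) → S, ∑ x'' ∈ Xp, ∑ x' : Fin (m + 1) → P,
                  ε ^ m * ((∏ i, a i (x'' i) (σ'' i) (x' i) (σ' i)) * ‖W σ' x'‖) :=
                sum_congr rfl fun σ'' _ => Finset.sum_comm
            _ = ∑ σ' : Fin (m + 1) → S, ∑ σ'' ∈ Ap, ∑ x'' ∈ Xp, ∑ x' : Fin (m + 1) → P,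
                  ε ^ m * ((∏ i, a i (x'' i) (σ'' i) (x' i) (σ' i)) * ‖W σ' x'‖) := Finset.sum_comm
            _ = ∑ σ' : Fin (m + 1) → S, ∑ σ'' ∈ Ap, ∑ x' : Fin (m + 1) → P, ∑ x'' ∈ Xp,
                  ε ^ m * ((∏ i, a i (x'' i) (σ'' i) (x' i) (σ' i)) * ‖W σ' x'‖) :=
                sum_congr rfl fun σ' _ => sum_congr rfl fun σ'' _ => Finset.sum_comm
            _ = ∑ σ' : Fin (m + 1) → S, ∑ x' : Fin (m + 1) → P, ∑ σ'' ∈ Ap, ∑ x'' ∈ Xp,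
                  ε ^ m * ((∏ i, a i (x'' i) (σ'' i) (x' i) (σ' i)) * ‖W σ' x'‖) :=
                sum_congr rfl fun σ' _ => Finset.sum_comm
            _ = _ := by
                refine sum_congr rfl fun σ' _ => sum_congr rfl fun x' _ => ?_
                rw [mul_sum, mul_sum]
                refine sum_congr rfl fun σ'' _ => ?_
                rw [mul_sum, mul_sum]
                exact sum_congr rfl fun x'' _ => by ring
  -- Step 2: the position sums factorise leg by leg; the pinned leg keeps its entry, the others cost `c₁` (or `0` off the children)
  have step2 : ∀ (σ'' : Fin (m + 1) → S'') (σ' : Fin (m + 1) → S) (x' : Fin (m + 1) → P), σ'' p = s'' →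
      ∑ x'' ∈ univ.filter (fun x'' : Fin (m + 1) → P'' => x'' p = x), ∏ i, a i (x'' i) (σ'' i) (x' i) (σ' i) ≤
        a p x s'' (x' p) (σ' p) * (if ∀ i, child (σ'' i) (σ' i) then c₁ ^ m else 0) := by
    intro σ'' σ' x' hσp
    -- the constrained position sum as a product of one-leg sums
    set t : Fin (m + 1) → Finset P'' := fun i => if i = p then {x} else univ with ht
    have hset : univ.filter (fun x'' : Fin (m + 1) → P'' => x'' p = x) = Fintype.piFinset t := by
      ext x''
      simp only [mem_filter, mem_univ, true_and, Fintype.mem_piFinset, ht]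
      constructor
      · intro h i
        split_ifs with hi
        · subst hi; simp [h]
        · exact mem_univ _
      · intro h
        simpa using h p
    have hfac : ∑ x'' ∈ univ.filter (fun x'' : Fin (m + 1) → P'' => x'' p = x), ∏ i, a i (x'' i) (σ'' i) (x' i) (σ' i) =
        a p x s'' (x' p) (σ' p) * ∏ i ∈ univ.erase p, ∑ j ∈ t i, a i j (σ'' i) (x' i) (σ' i) := by
      rw [hset, ← prod_univ_sum t (fun i j => a i j (σ'' i) (x' i) (σ' i)),
        ← Finset.mul_prod_erase univ (fun i => ∑ j ∈ t i, a i j (σ'' i) (x' i) (σ' i)) (mem_univ p)]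
      congr 1
      simp only [ht, if_true, sum_singleton, hσp]
    rw [hfac]
    have hP0 : 0 ≤ ∏ i ∈ univ.erase p, ∑ j ∈ t i, a i j (σ'' i) (x' i) (σ' i) :=
      prod_nonneg fun i _ => sum_nonneg fun j _ => ha0 i j _ _ _
    split_ifs with hch
    · -- every other leg: full position sum `≤ c₁`
      refine mul_le_mul_of_nonneg_left ?_ (ha0 p x s'' (x' p) (σ' p))
      have hcard : (univ.erase p).card = m := by rw [card_erase_of_mem (mem_univ p), card_univ, Fintype.card_fin]; omega
      calc ∏ i ∈ univ.erase p, ∑ j ∈ t i, a i j (σ'' i) (x' i) (σ' i) ≤ ∏ i ∈ univ.erase p, c₁ := by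
            refine prod_le_prod (fun i _ => sum_nonneg fun j _ => ha0 i j _ _ _) fun i hi => ?_
            have hip : i ≠ p := ne_of_mem_erase hi
            simp only [ht, if_neg hip]
            exact h1 _ _ _
        _ = c₁ ^ m := by rw [prod_const, hcard]
    · -- some leg is not a child: either the pinned entry or one of the other factors vanishes
      rw [mul_zero]
      push Not at hch
      obtain ⟨i, hi⟩ := hch
      by_cases hip : i = p
      · subst hip
        have hz : a i x s'' (x' i) (σ' i) = 0 := by
          simp only [ha]
          rw [hT0 _ _ _ _ (hσp ▸ hi), norm_zero]
        rw [hz, zero_mul]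
      · refine le_of_eq ?_
        rw [prod_eq_zero (mem_erase.2 ⟨hip, mem_univ i⟩) ?_, mul_zero]
        simp only [ht, if_neg hip]
        exact sum_eq_zero fun j _ => by
          simp only [ha]
          rw [hT0 _ _ _ _ hi, norm_zero]
  -- Step 3: the sector sum over the admissible fine tuples costs the refinement count
  have step3 : ∀ (σ' : Fin (m + 1) → S) (x' : Fin (m + 1) → P),
      ∑ σ'' ∈ A''.filter (fun σ'' => σ'' p = s''),
          ∑ x'' ∈ univ.filter (fun x'' : Fin (m + 1) → P'' => x'' p = x), ∏ i, a i (x'' i) (σ'' i) (x' i) (σ' i) ≤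
        a p x s'' (x' p) (σ' p) * (c₁ ^ m * R) := by
    intro σ' x'
    calc ∑ σ'' ∈ A''.filter (fun σ'' => σ'' p = s''),
          ∑ x'' ∈ univ.filter (fun x'' : Fin (m + 1) → P'' => x'' p = x), ∏ i, a i (x'' i) (σ'' i) (x' i) (σ' i)
        ≤ ∑ σ'' ∈ A''.filter (fun σ'' => σ'' p = s''),
            a p x s'' (x' p) (σ' p) * (if ∀ i, child (σ'' i) (σ' i) then c₁ ^ m else 0) :=
          sum_le_sum fun σ'' hσ'' => step2 σ'' σ' x' (mem_filter.1 hσ'').2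
      _ = a p x s'' (x' p) (σ' p) * (c₁ ^ m *
            (((A''.filter fun σ'' => σ'' p = s'' ∧ ∀ i, child (σ'' i) (σ' i)).card : ℝ))) := by
          rw [← mul_sum, ← sum_filter, filter_filter, sum_const, nsmul_eq_mul]
          ring
      _ ≤ a p x s'' (x' p) (σ' p) * (c₁ ^ m * R) :=
          mul_le_mul_of_nonneg_left (mul_le_mul_of_nonneg_left (hR σ' p s'') (pow_nonneg hc₁ _)) (ha0 p x s'' (x' p) (σ' p))
  -- Step 4: collect; Step 5: the remaining coarse sum, fiberwise over the pinned leg's coarse label, is `≤ cr · ‖W‖`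
  have step5 : ∑ σ' : Fin (m + 1) → S, ∑ x' : Fin (m + 1) → P, ‖W σ' x'‖ * (ε ^ m * a p x s'' (x' p) (σ' p)) ≤ cr * nW := by
    -- fiberwise over `(σ' p, x' p)`
    have hfib : ∑ σ' : Fin (m + 1) → S, ∑ x' : Fin (m + 1) → P, ‖W σ' x'‖ * (ε ^ m * a p x s'' (x' p) (σ' p)) =
        ∑ s' : S, ∑ y : P, a p x s'' y s' *
          (∑ σ' ∈ univ.filter (fun σ' : Fin (m + 1) → S => σ' p = s'),
            ε ^ m * ∑ x' ∈ univ.filter (fun x' : Fin (m + 1) → P => x' p = y), ‖W σ' x'‖) := by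
      calc ∑ σ' : Fin (m + 1) → S, ∑ x' : Fin (m + 1) → P, ‖W σ' x'‖ * (ε ^ m * a p x s'' (x' p) (σ' p))
          = ∑ s' : S, ∑ σ' ∈ univ.filter (fun σ' : Fin (m + 1) → S => σ' p = s'),
              ∑ y : P, ∑ x' ∈ univ.filter (fun x' : Fin (m + 1) → P => x' p = y), ‖W σ' x'‖ * (ε ^ m * a p x s'' y s') := by
            rw [← Finset.sum_fiberwise univ (fun σ' : Fin (m + 1) → S => σ' p) _]
            refine sum_congr rfl fun s' _ => sum_congr rfl fun σ' hσ' => ?_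
            have hs' : σ' p = s' := (mem_filter.1 hσ').2
            rw [← Finset.sum_fiberwise univ (fun x' : Fin (m + 1) → P => x' p) _]
            refine sum_congr rfl fun y _ => sum_congr rfl fun x' hx' => ?_
            rw [(mem_filter.1 hx').2, hs']
        _ = ∑ s' : S, ∑ y : P, ∑ σ' ∈ univ.filter (fun σ' : Fin (m + 1) → S => σ' p = s'),
              ∑ x' ∈ univ.filter (fun x' : Fin (m + 1) → P => x' p = y), ‖W σ' x'‖ * (ε ^ m * a p x s'' y s') :=
            sum_congr rfl fun s' _ => Finset.sum_comm
        _ = _ := by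
            refine sum_congr rfl fun s' _ => sum_congr rfl fun y _ => ?_
            rw [mul_sum]
            refine sum_congr rfl fun σ' _ => ?_
            rw [mul_sum, mul_sum]
            exact sum_congr rfl fun x' _ => by ring
    rw [hfib]
    -- each fibre sum is a leg sum of `W` over `univ`, hence `≤ ‖W‖`
    have hrowT : ∑ s' : S, ∑ y : P, a p x s'' y s' = ∑ X' : P × S, ‖T (x, s'') X'‖ := by
      rw [Fintype.sum_prod_type, Finset.sum_comm]
    calc ∑ s' : S, ∑ y : P, a p x s'' y s' *
          (∑ σ' ∈ univ.filter (fun σ' : Fin (m + 1) → S => σ' p = s'),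
            ε ^ m * ∑ x' ∈ univ.filter (fun x' : Fin (m + 1) → P => x' p = y), ‖W σ' x'‖)
        ≤ ∑ s' : S, ∑ y : P, a p x s'' y s' * nW := by
          refine sum_le_sum fun s' _ => sum_le_sum fun y _ => mul_le_mul_of_nonneg_left ?_ (ha0 p x s'' y s')
          have h := sectorLegSum_le_sectorisedKernelNorm ε (univ : Finset (Fin (m + 1) → S)) W p s' y
          rw [sectorLegSum] at h
          exact h
      _ = (∑ s' : S, ∑ y : P, a p x s'' y s') * nW := by
          rw [Finset.sum_mul]
          exact sum_congr rfl fun s' _ => by rw [Finset.sum_mul]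
      _ ≤ cr * nW := by
          rw [hrowT]
          exact mul_le_mul_of_nonneg_right (h2 (x, s'')) hnW0
  -- assemble
  calc sectorLegSum ε A''
        (fun σ'' x'' => ∑ σ' : Fin (m + 1) → S, ∑ x' : Fin (m + 1) → P, (∏ i, T (x'' i, σ'' i) (x' i, σ' i)) * W σ' x') p s'' x
      ≤ ∑ σ' : Fin (m + 1) → S, ∑ x' : Fin (m + 1) → P, ‖W σ' x'‖ *
          (ε ^ m * ∑ σ'' ∈ A''.filter (fun σ'' => σ'' p = s''),
            ∑ x'' ∈ univ.filter (fun x'' : Fin (m + 1) → P'' => x'' p = x), ∏ i, a i (x'' i) (σ'' i) (x' i) (σ' i)) := step1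
    _ ≤ ∑ σ' : Fin (m + 1) → S, ∑ x' : Fin (m + 1) → P, ‖W σ' x'‖ * (ε ^ m * (a p x s'' (x' p) (σ' p) * (c₁ ^ m * R))) :=
        sum_le_sum fun σ' _ => sum_le_sum fun x' _ =>
          mul_le_mul_of_nonneg_left (mul_le_mul_of_nonneg_left (step3 σ' x') (pow_nonneg hε _)) (norm_nonneg _)
    _ = c₁ ^ m * R * ∑ σ' : Fin (m + 1) → S, ∑ x' : Fin (m + 1) → P, ‖W σ' x'‖ * (ε ^ m * a p x s'' (x' p) (σ' p)) := by
        rw [mul_sum]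
        refine sum_congr rfl fun σ' _ => ?_
        rw [mul_sum]
        exact sum_congr rfl fun x' _ => by ring
    _ ≤ c₁ ^ m * R * (cr * nW) := mul_le_mul_of_nonneg_left step5 (by positivity)
    _ = cr * c₁ ^ m * R * nW := by ring

/-- **The sectorised norm under a child-supported leg-wise transform**: with the data of `sectorLegSum_refine_le`,
`‖W″‖_{A″} ≤ cr · c₁^m · R · ‖W‖_{univ}` (BGM 2006 (2.89): refinement count × one overlap norm per leg).
[cite: BenfattoGiulianiMastropietro2006, §2.8 (2.82)-(2.83) and (2.89)] -/
theorem sectorisedKernelNorm_refine_le [Finite S''] {ε : ℝ} (hε : 0 ≤ ε) {m : ℕ} (T : P'' × S'' → P × S → 𝕜)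
    (child : S'' → S → Prop) [DecidableRel child] (hT0 : ∀ x'' s'' x' s', ¬ child s'' s' → T (x'', s'') (x', s') = 0)
    {c₁ cr R : ℝ} (hc₁ : 0 ≤ c₁) (hcr : 0 ≤ cr) (hR0 : 0 ≤ R)
    (h1 : ∀ (s'' : S'') (x' : P) (s' : S), ∑ x'' : P'', ‖T (x'', s'') (x', s')‖ ≤ c₁)
    (h2 : ∀ X'' : P'' × S'', ∑ X' : P × S, ‖T X'' X'‖ ≤ cr)
    (A'' : Finset (Fin (m + 1) → S''))
    (hR : ∀ (σ' : Fin (m + 1) → S) (p : Fin (m + 1)) (s'' : S''),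
      (((A''.filter fun σ'' => σ'' p = s'' ∧ ∀ i, child (σ'' i) (σ' i)).card : ℝ)) ≤ R)
    (W : (Fin (m + 1) → S) → (Fin (m + 1) → P) → 𝕜) :
    sectorisedKernelNorm ε (m + 1) A''
        (fun σ'' x'' => ∑ σ' : Fin (m + 1) → S, ∑ x' : Fin (m + 1) → P, (∏ i, T (x'' i, σ'' i) (x' i, σ' i)) * W σ' x') ≤
      cr * c₁ ^ m * R * sectorisedKernelNorm ε (m + 1) (univ : Finset (Fin (m + 1) → S)) W :=
  sectorisedKernelNorm_le_of_forall_le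
    (mul_nonneg (by positivity) (sectorisedKernelNorm_nonneg hε _ _ _)) fun p s'' x =>
    sectorLegSum_refine_le hε T child hT0 hc₁ hR0 h1 h2 A'' hR W p s'' x


omit [DecidableEq S] [DecidableEq S''] in
/-- **Per-tuple pinned sizes under a child-supported leg-wise transform** (BGM 2006 (2.82): one overlap `L¹` norm per leg, for ONE fine sector
tuple — no sector sum): with `W″_{σ″}(x″) = Σ_{σ′,x′} ∏_i T((x″_i,σ″_i),(x′_i,σ′_i)) W_{σ′}(x′)`, `T = 0` off the child relation, per-pair position sums
`Σ_{x″} ‖T((x″,s″),(x′,s′))‖ ≤ c₁` and `Σ_{x′} ‖T((x″,s″),(x′,s′))‖ ≤ c₁r`, at most `P` coarse tuples of which a fine tuple is a leg-wise child, and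
pinned sizes `ε^m Σ_{x′ : x′_p = y} ‖W_{σ′}(x′)‖ ≤ B` for every coarse tuple, leg and position: for every fine tuple `σ″`, leg `p` and position `x`,
`ε^m Σ_{x″ : x″_p = x} ‖W″_{σ″}(x″)‖ ≤ c₁^m · c₁r · P · B`. [cite: BenfattoGiulianiMastropietro2006, §2.8 (2.82)] -/
theorem pinnedSum_refine_le {ε : ℝ} (hε : 0 ≤ ε) {m : ℕ} (T : P'' × S'' → P × S → 𝕜) (child : S'' → S → Prop)
    [DecidableRel child] (hT0 : ∀ x'' s'' x' s', ¬ child s'' s' → T (x'', s'') (x', s') = 0)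
    {c₁ c₁r Pc B : ℝ} (hc₁ : 0 ≤ c₁) (hc₁r : 0 ≤ c₁r) (hB : 0 ≤ B)
    (h1 : ∀ (s'' : S'') (x' : P) (s' : S), ∑ x'' : P'', ‖T (x'', s'') (x', s')‖ ≤ c₁)
    (h1r : ∀ (x'' : P'') (s'' : S'') (s' : S), ∑ x' : P, ‖T (x'', s'') (x', s')‖ ≤ c₁r)
    (hPc : ∀ σ'' : Fin (m + 1) → S'',
      (((univ.filter fun σ' : Fin (m + 1) → S => ∀ i, child (σ'' i) (σ' i)).card : ℝ)) ≤ Pc)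
    (W : (Fin (m + 1) → S) → (Fin (m + 1) → P) → 𝕜)
    (hBW : ∀ (σ' : Fin (m + 1) → S) (p : Fin (m + 1)) (y : P),
      ε ^ m * ∑ x' ∈ univ.filter (fun x' : Fin (m + 1) → P => x' p = y), ‖W σ' x'‖ ≤ B)
    (σ'' : Fin (m + 1) → S'') (p : Fin (m + 1)) (x : P'') :
    ε ^ m * ∑ x'' ∈ univ.filter (fun x'' : Fin (m + 1) → P'' => x'' p = x),
        ‖∑ σ' : Fin (m + 1) → S, ∑ x' : Fin (m + 1) → P, (∏ i, T (x'' i, σ'' i) (x' i, σ' i)) * W σ' x'‖ ≤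
      c₁ ^ m * c₁r * Pc * B := by
  -- abbreviation for the absolute transform entries
  set a : Fin (m + 1) → P'' → S'' → P → S → ℝ := fun _ x'' s'' x' s' => ‖T (x'', s'') (x', s')‖ with ha
  have ha0 : ∀ i x'' s'' x' s', 0 ≤ a i x'' s'' x' s' := fun _ _ _ _ _ => norm_nonneg _
  set Xp := univ.filter (fun x'' : Fin (m + 1) → P'' => x'' p = x) with hXp
  -- Step 1: triangle inequality and reordering
  have step1 : ε ^ m * ∑ x'' ∈ Xp,
        ‖∑ σ' : Fin (m + 1) → S, ∑ x' : Fin (m + 1) → P, (∏ i, T (x'' i, σ'' i) (x' i, σ' i)) * W σ' x'‖ ≤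
      ∑ σ' : Fin (m + 1) → S, ∑ x' : Fin (m + 1) → P, ‖W σ' x'‖ * (ε ^ m * ∑ x'' ∈ Xp, ∏ i, a i (x'' i) (σ'' i) (x' i) (σ' i)) := by
    calc ε ^ m * ∑ x'' ∈ Xp, ‖∑ σ' : Fin (m + 1) → S, ∑ x' : Fin (m + 1) → P, (∏ i, T (x'' i, σ'' i) (x' i, σ' i)) * W σ' x'‖
        ≤ ε ^ m * ∑ x'' ∈ Xp, ∑ σ' : Fin (m + 1) → S, ∑ x' : Fin (m + 1) → P,
            (∏ i, a i (x'' i) (σ'' i) (x' i) (σ' i)) * ‖W σ' x'‖ := by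
          refine mul_le_mul_of_nonneg_left (sum_le_sum fun x'' _ => ?_) (pow_nonneg hε _)
          refine (norm_sum_le _ _).trans (sum_le_sum fun σ' _ => (norm_sum_le _ _).trans (sum_le_sum fun x' _ => ?_))
          rw [norm_mul, norm_prod]
      _ = _ := by
          rw [mul_sum]
          calc ∑ x'' ∈ Xp, ε ^ m * ∑ σ' : Fin (m + 1) → S, ∑ x' : Fin (m + 1) → P,
                (∏ i, a i (x'' i) (σ'' i) (x' i) (σ' i)) * ‖W σ' x'‖
              = ∑ x'' ∈ Xp, ∑ σ' : Fin (m + 1) → S, ∑ x' : Fin (m + 1) → P,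
                  ε ^ m * ((∏ i, a i (x'' i) (σ'' i) (x' i) (σ' i)) * ‖W σ' x'‖) := by simp only [mul_sum]
            _ = ∑ σ' : Fin (m + 1) → S, ∑ x'' ∈ Xp, ∑ x' : Fin (m + 1) → P,
                  ε ^ m * ((∏ i, a i (x'' i) (σ'' i) (x' i) (σ' i)) * ‖W σ' x'‖) := Finset.sum_comm
            _ = ∑ σ' : Fin (m + 1) → S, ∑ x' : Fin (m + 1) → P, ∑ x'' ∈ Xp,
                  ε ^ m * ((∏ i, a i (x'' i) (σ'' i) (x' i) (σ' i)) * ‖W σ' x'‖) :=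
                sum_congr rfl fun σ' _ => Finset.sum_comm
            _ = _ := by
                refine sum_congr rfl fun σ' _ => sum_congr rfl fun x' _ => ?_
                rw [mul_sum, mul_sum]
                exact sum_congr rfl fun x'' _ => by ring
  -- Step 2: the position sums factorise leg by leg; the pinned leg keeps its entry, the others cost `c₁` (or `0` off the children)
  have step2 : ∀ (σ' : Fin (m + 1) → S) (x' : Fin (m + 1) → P),
      ∑ x'' ∈ Xp, ∏ i, a i (x'' i) (σ'' i) (x' i) (σ' i) ≤
        a p x (σ'' p) (x' p) (σ' p) * (if ∀ i, child (σ'' i) (σ' i) then c₁ ^ m else 0) := by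
    intro σ' x'
    set t : Fin (m + 1) → Finset P'' := fun i => if i = p then {x} else univ with ht
    have hset : Xp = Fintype.piFinset t := by
      ext x''
      simp only [hXp, mem_filter, mem_univ, true_and, Fintype.mem_piFinset, ht]
      constructor
      · intro h i
        split_ifs with hi
        · subst hi; simp [h]
        · exact mem_univ _
      · intro h
        simpa using h p
    have hfac : ∑ x'' ∈ Xp, ∏ i, a i (x'' i) (σ'' i) (x' i) (σ' i) =
        a p x (σ'' p) (x' p) (σ' p) * ∏ i ∈ univ.erase p, ∑ j ∈ t i, a i j (σ'' i) (x' i) (σ' i) := by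
      rw [hset, ← prod_univ_sum t (fun i j => a i j (σ'' i) (x' i) (σ' i)),
        ← Finset.mul_prod_erase univ (fun i => ∑ j ∈ t i, a i j (σ'' i) (x' i) (σ' i)) (mem_univ p)]
      congr 1
      simp only [ht, if_true, sum_singleton]
    rw [hfac]
    split_ifs with hch
    · refine mul_le_mul_of_nonneg_left ?_ (ha0 p x (σ'' p) (x' p) (σ' p))
      have hcard : (univ.erase p).card = m := by rw [card_erase_of_mem (mem_univ p), card_univ, Fintype.card_fin]; omega
      calc ∏ i ∈ univ.erase p, ∑ j ∈ t i, a i j (σ'' i) (x' i) (σ' i) ≤ ∏ i ∈ univ.erase p, c₁ := by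
            refine prod_le_prod (fun i _ => sum_nonneg fun j _ => ha0 i j _ _ _) fun i hi => ?_
            have hip : i ≠ p := ne_of_mem_erase hi
            simp only [ht, if_neg hip]
            exact h1 _ _ _
        _ = c₁ ^ m := by rw [prod_const, hcard]
    · rw [mul_zero]
      push Not at hch
      obtain ⟨i, hi⟩ := hch
      by_cases hip : i = p
      · subst hip
        have hz : a i x (σ'' i) (x' i) (σ' i) = 0 := by
          simp only [ha]
          rw [hT0 _ _ _ _ hi, norm_zero]
        rw [hz, zero_mul]
      · refine le_of_eq ?_
        rw [prod_eq_zero (mem_erase.2 ⟨hip, mem_univ i⟩) ?_, mul_zero]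
        simp only [ht, if_neg hip]
        exact sum_eq_zero fun j _ => by
          simp only [ha]
          rw [hT0 _ _ _ _ hi, norm_zero]
  -- Step 3: for each coarse parent, the remaining coarse position sum, fiberwise over the pinned leg, is `≤ c₁r · B`
  have step3 : ∀ σ' : Fin (m + 1) → S,
      ∑ x' : Fin (m + 1) → P, ‖W σ' x'‖ * (ε ^ m * a p x (σ'' p) (x' p) (σ' p)) ≤ c₁r * B := by
    intro σ'
    have hfib : ∑ x' : Fin (m + 1) → P, ‖W σ' x'‖ * (ε ^ m * a p x (σ'' p) (x' p) (σ' p)) =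
        ∑ y : P, a p x (σ'' p) y (σ' p) *
          (ε ^ m * ∑ x' ∈ univ.filter (fun x' : Fin (m + 1) → P => x' p = y), ‖W σ' x'‖) := by
      rw [← Finset.sum_fiberwise univ (fun x' : Fin (m + 1) → P => x' p) _]
      refine sum_congr rfl fun y _ => ?_
      rw [mul_sum, mul_sum]
      refine sum_congr rfl fun x' hx' => ?_
      rw [(mem_filter.1 hx').2]
      ring
    rw [hfib]
    calc ∑ y : P, a p x (σ'' p) y (σ' p) * (ε ^ m * ∑ x' ∈ univ.filter (fun x' : Fin (m + 1) → P => x' p = y), ‖W σ' x'‖)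
        ≤ ∑ y : P, a p x (σ'' p) y (σ' p) * B :=
          sum_le_sum fun y _ => mul_le_mul_of_nonneg_left (hBW σ' p y) (ha0 p x (σ'' p) y (σ' p))
      _ = (∑ y : P, a p x (σ'' p) y (σ' p)) * B := by rw [Finset.sum_mul]
      _ ≤ c₁r * B := mul_le_mul_of_nonneg_right (h1r x (σ'' p) (σ' p)) hB
  -- assemble
  calc ε ^ m * ∑ x'' ∈ Xp, ‖∑ σ' : Fin (m + 1) → S, ∑ x' : Fin (m + 1) → P, (∏ i, T (x'' i, σ'' i) (x' i, σ' i)) * W σ' x'‖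
      ≤ ∑ σ' : Fin (m + 1) → S, ∑ x' : Fin (m + 1) → P, ‖W σ' x'‖ * (ε ^ m * ∑ x'' ∈ Xp, ∏ i, a i (x'' i) (σ'' i) (x' i) (σ' i)) := step1
    _ ≤ ∑ σ' : Fin (m + 1) → S, ∑ x' : Fin (m + 1) → P,
          ‖W σ' x'‖ * (ε ^ m * (a p x (σ'' p) (x' p) (σ' p) * (if ∀ i, child (σ'' i) (σ' i) then c₁ ^ m else 0))) :=
        sum_le_sum fun σ' _ => sum_le_sum fun x' _ =>
          mul_le_mul_of_nonneg_left (mul_le_mul_of_nonneg_left (step2 σ' x') (pow_nonneg hε _)) (norm_nonneg _)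
    _ = ∑ σ' : Fin (m + 1) → S, (if ∀ i, child (σ'' i) (σ' i) then c₁ ^ m else 0) *
          ∑ x' : Fin (m + 1) → P, ‖W σ' x'‖ * (ε ^ m * a p x (σ'' p) (x' p) (σ' p)) := by
        refine sum_congr rfl fun σ' _ => ?_
        rw [mul_sum]
        exact sum_congr rfl fun x' _ => by ring
    _ ≤ ∑ σ' : Fin (m + 1) → S, (if ∀ i, child (σ'' i) (σ' i) then c₁ ^ m else 0) * (c₁r * B) :=
        sum_le_sum fun σ' _ => mul_le_mul_of_nonneg_left (step3 σ') (by split_ifs <;> positivity)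
    _ = c₁ ^ m * (c₁r * B) * (((univ.filter fun σ' : Fin (m + 1) → S => ∀ i, child (σ'' i) (σ' i)).card : ℝ)) := by
        rw [← Finset.sum_mul, ← sum_filter, sum_const, nsmul_eq_mul]
        ring
    _ ≤ c₁ ^ m * (c₁r * B) * Pc := mul_le_mul_of_nonneg_left (hPc σ'') (by positivity)
    _ = c₁ ^ m * c₁r * Pc * B := by ring

end Literature.MathematicalPhysics.QuantumLattice

end
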